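import Mathlib
import Literature.MathematicalPhysics.QuantumLattice.FramePosKernelFirstMoment
import HarnessLib

/-!
# The SECOND MOMENT `Σ_z |z̃|_∞² ‖Ǩ_L(z)‖` of a frame's lattice position kernel from the frame's SECOND and FOURTH directional derivatives

Topic `MathematicalPhysics/QuantumLattice`; sequel of `FramePosKernelFirstMoment.lean` (Bernstein's DYADIC route, orders `1` and `3`:
`Σ_z |z̃|_∞ ‖Ǩ_L(z)‖ ≤ 32√2·π·B₁·2^t + 1024√2·π³·B₃/2^t`).  The same route one moment higher: on the shell `{2^j ≤ |z̃|_∞ < 2^{j+1}}` the weight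
`|z̃|_∞²` is `≤ 4·4^j`, and the shell is paid by the `N`-th coarse axis difference of the samples, `≤ (π/2^j)^N·‖∂^N K‖_∞`, for the two orders
`N = 2` and `N = 4`:

  `Σ_z |z̃|_∞²·‖Ǩ_L(z)‖ ≤ 256√2·π²·B₂·2^t + 8192√2·π⁴·B₄/2^t`   for every integer crossover `t`
  (**`sum_torusSupNorm_sq_mul_norm_framePosKernel_le`**; `B_N ≥ sup_{p,l,s} |∂_s^N K(p + s e_l)|`),

uniformly in `L` — i.e. `≲ √(B₂B₄)` with `2^t ≍ √(B₄/B₂)`.  For a frame piece of the KL-regime counterterm (`‖D²K‖ ≍ Gfr₂U²`,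
`‖D⁴K‖ ≍ Gfr₄U²·16^{n}`, take `2^t = 4^n`) this is `≍ (Gfr₂ + Gfr₄)·U²` uniformly in the scale `n` of the piece, so the second position moment of
the whole counterterm kernel is `O((N+1)U²) = O(c)` — the input `N_{w²}(1)` of the `(1 + diam)²`-weighted scale-`0` step (cell gate-hubbard-kl,
off-diagonal second spatial moment of the two-leg kernel, `stub_twoLeg_scale0`).

* **`sum_torusSupNorm_sq_mul_norm_framePosKernel_le_dyadic`** (general two orders `N₁, N₂`, shell form, weight `|z̃|_∞²`);
* **`sum_torusSupNorm_sq_mul_norm_framePosKernel_le`** (`N₁ = 2`, `N₂ = 4`, free crossover `t`).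

Everything is proved; no definitions, no named facts.

## Sources

A. Zygmund, *Trigonometric Series* Vol. I, CUP 2002, Ch. VI §3, Thm 3.1 (Bernstein) [`Zygmund2002`]; G. Benfatto, A. Giuliani,
V. Mastropietro, Ann. Henri Poincaré 4 (2003) 137–193, §1.2 (2.10) (the counterterm and its position kernel) [`BenfattoGiulianiMastropietro2003`];
S. Friedli, Y. Velenik, CUP 2017, §10.4 [`FriedliVelenik2017`].
-/

noncomputable section

namespace Literature.MathematicalPhysics.QuantumLattice

open Finset Literature.Probability.LatticeModels
open scoped Real ComplexConjugate

variable {L : ℕ} [NeZero L]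

/-- **Dyadic second-moment bound, shell form**: with two directional derivative laws `‖∂^{N₁}K‖ ≤ B₁`, `‖∂^{N₂}K‖ ≤ B₂` (line restrictions
along both axes, all base points),
`Σ_z |z̃|_∞²·‖Ǩ_L(z)‖ ≤ Σ_{j ≤ log₂ L} 16√2·8^j · min((4π)^{N₁} 2^{-jN₁} B₁, (4π)^{N₂} 2^{-jN₂} B₂)` — each dyadic shell (weight `≤ 4·4^j`)
paid by the better law. [cite: Zygmund2002, Ch. VI §3 Thm 3.1] -/
theorem sum_torusSupNorm_sq_mul_norm_framePosKernel_le_dyadic (K : TrigPolyC4v) {N₁ N₂ : ℕ} {B₁ B₂ : ℝ}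
    (hK₁ : ∀ (l : Fin 2) (p : Fin 2 → ℝ), ContDiff ℝ N₁ (fun s : ℝ => K.eval (p + s • (Pi.single l (1 : ℝ) : Fin 2 → ℝ))) ∧
      ∀ t, ‖iteratedDeriv N₁ (fun s : ℝ => K.eval (p + s • (Pi.single l (1 : ℝ) : Fin 2 → ℝ))) t‖ ≤ B₁)
    (hK₂ : ∀ (l : Fin 2) (p : Fin 2 → ℝ), ContDiff ℝ N₂ (fun s : ℝ => K.eval (p + s • (Pi.single l (1 : ℝ) : Fin 2 → ℝ))) ∧
      ∀ t, ‖iteratedDeriv N₂ (fun s : ℝ => K.eval (p + s • (Pi.single l (1 : ℝ) : Fin 2 → ℝ))) t‖ ≤ B₂) :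
    ∑ z : TorusSite 2 L, ((torusSupNorm z : ℝ) ^ 2) * ‖framePosKernel L K z‖ ≤
      ∑ j ∈ range (Nat.log 2 L + 1), 16 * Real.sqrt 2 * (8 : ℝ) ^ j *
        min ((4 * π) ^ N₁ * ((2 : ℝ) ^ j)⁻¹ ^ N₁ * B₁) ((4 * π) ^ N₂ * ((2 : ℝ) ^ j)⁻¹ ^ N₂ * B₂) := by
  have hB₁0 : 0 ≤ B₁ := le_trans (norm_nonneg _) ((hK₁ 0 0).2 0)
  have hB₂0 : 0 ≤ B₂ := le_trans (norm_nonneg _) ((hK₂ 0 0).2 0)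
  set h : TorusSite 2 L → ℂ := fun q => (K.eval (latticeMomentum L q) : ℂ) with hh
  have hmain := sum_weight_mul_norm_kernel_le_dyadic (d := 2) (L := L) h (fun z => (torusSupNorm z : ℝ) ^ 2)
    (fun z => by positivity) N₁ N₂ (fun j => (2 * (2 : ℝ) ^ j) ^ 2) (fun j => (π / (2 : ℝ) ^ j) ^ N₁ * B₁)
    (fun j => (π / (2 : ℝ) ^ j) ^ N₂ * B₂) (fun j => by positivity) (fun j => by positivity) (fun j => by positivity)
    (fun j z hz => ?_) (fun j hjL i k => ?_) (fun j hjL i k => ?_)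
  rotate_left
  · -- weight ≤ (2·2^j)² on the shell
    have := (mem_cubeShell.1 hz).2
    have h2 : ((torusSupNorm z : ℕ) : ℝ) < ((2 * 2 ^ j : ℕ) : ℝ) := by exact_mod_cast this
    push_cast at h2
    have h0 : (0 : ℝ) ≤ (torusSupNorm z : ℝ) := Nat.cast_nonneg _
    exact pow_le_pow_left₀ h0 h2.le 2
  · have := norm_fwdDiff_iter_sample_le K hK₁ (Nat.two_pow_pos j) hjL i k
    push_cast at this ⊢
    exact this
  · have := norm_fwdDiff_iter_sample_le K hK₂ (Nat.two_pow_pos j) hjL i k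
    push_cast at this ⊢
    exact this
  simp_rw [norm_framePosKernel_eq]
  have h0 : ((torusSupNorm (0 : TorusSite 2 L) : ℕ) : ℝ) = 0 := by
    rw [(torusSupNorm_eq_zero_iff (0 : TorusSite 2 L)).2 rfl, Nat.cast_zero]
  rw [h0, zero_pow two_ne_zero, zero_mul, zero_add] at hmain
  push_cast at hmain
  refine hmain.trans (sum_le_sum fun j _ => le_of_eq ?_)
  have hs4 : Real.sqrt ((4 * (2 : ℝ) ^ j) ^ 2) = 4 * 2 ^ j := Real.sqrt_sq (by positivity)
  have e₁ : (4 : ℝ) ^ N₁ * ((π / (2 : ℝ) ^ j) ^ N₁ * B₁) = (4 * π) ^ N₁ * ((2 : ℝ) ^ j)⁻¹ ^ N₁ * B₁ := by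
    rw [div_eq_mul_inv, mul_pow, mul_pow]; ring
  have e₂ : (4 : ℝ) ^ N₂ * ((π / (2 : ℝ) ^ j) ^ N₂ * B₂) = (4 * π) ^ N₂ * ((2 : ℝ) ^ j)⁻¹ ^ N₂ * B₂ := by
    rw [div_eq_mul_inv, mul_pow, mul_pow]; ring
  have h8j : (8 : ℝ) ^ j = 2 ^ j * 2 ^ j * 2 ^ j := by rw [← mul_pow, ← mul_pow]; norm_num
  rw [hs4, e₁, e₂, h8j]
  ring

/-- **The second moment of the frame's lattice position kernel from the SECOND and FOURTH directional derivative laws**: if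
`|∂_s² K(p + s e_l)| ≤ B₂` and `|∂_s⁴ K(p + s e_l)| ≤ B₄` for all base points and both axes, then for every integer crossover `t`,
`Σ_z |z̃|_∞²·‖Ǩ_L(z)‖ ≤ 256√2·π²·B₂·2^t + 8192√2·π⁴·B₄/2^t`, uniformly in `L` (so `≲ √(B₂B₄)` at `2^t ≍ √(B₄/B₂)`; for a frame piece with
`B₂ ≍ Gfr₂U²`, `B₄ ≍ Gfr₄U²16^{n}` take `2^t = 4^n`: `≲ (Gfr₂ + Gfr₄)·U²` uniformly in `n`). [cite: Zygmund2002, Ch. VI §3 Thm 3.1] -/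
theorem sum_torusSupNorm_sq_mul_norm_framePosKernel_le (K : TrigPolyC4v) {B₂ B₄ : ℝ}
    (hK₂ : ∀ (l : Fin 2) (p : Fin 2 → ℝ), ContDiff ℝ 2 (fun s : ℝ => K.eval (p + s • (Pi.single l (1 : ℝ) : Fin 2 → ℝ))) ∧
      ∀ t, ‖iteratedDeriv 2 (fun s : ℝ => K.eval (p + s • (Pi.single l (1 : ℝ) : Fin 2 → ℝ))) t‖ ≤ B₂)
    (hK₄ : ∀ (l : Fin 2) (p : Fin 2 → ℝ), ContDiff ℝ 4 (fun s : ℝ => K.eval (p + s • (Pi.single l (1 : ℝ) : Fin 2 → ℝ))) ∧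
      ∀ t, ‖iteratedDeriv 4 (fun s : ℝ => K.eval (p + s • (Pi.single l (1 : ℝ) : Fin 2 → ℝ))) t‖ ≤ B₄)
    (t : ℕ) :
    ∑ z : TorusSite 2 L, ((torusSupNorm z : ℝ) ^ 2) * ‖framePosKernel L K z‖ ≤
      256 * Real.sqrt 2 * π ^ 2 * B₂ * 2 ^ t + 8192 * Real.sqrt 2 * π ^ 4 * B₄ / 2 ^ t := by
  have hB₂0 : 0 ≤ B₂ := le_trans (norm_nonneg _) ((hK₂ 0 0).2 0)
  have hB₄0 : 0 ≤ B₄ := le_trans (norm_nonneg _) ((hK₄ 0 0).2 0)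
  have hdy := sum_torusSupNorm_sq_mul_norm_framePosKernel_le_dyadic (L := L) K hK₂ hK₄
  set a : ℝ := 256 * Real.sqrt 2 * π ^ 2 * B₂ with ha
  set b : ℝ := 4096 * Real.sqrt 2 * π ^ 4 * B₄ with hb
  have ha0 : 0 ≤ a := by rw [ha]; positivity
  have hb0 : 0 ≤ b := by rw [hb]; positivity
  -- each shell term is `≤ min (a·2^j) (b/2^j)`
  have hterm : ∀ j : ℕ, 16 * Real.sqrt 2 * (8 : ℝ) ^ j *
      min ((4 * π) ^ 2 * ((2 : ℝ) ^ j)⁻¹ ^ 2 * B₂) ((4 * π) ^ 4 * ((2 : ℝ) ^ j)⁻¹ ^ 4 * B₄) ≤ min (a * 2 ^ j) (b / 2 ^ j) := by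
    intro j
    have hc : 0 ≤ 16 * Real.sqrt 2 * (8 : ℝ) ^ j := by positivity
    have h2j : (0 : ℝ) < 2 ^ j := by positivity
    have h8j : (8 : ℝ) ^ j = 2 ^ j * 2 ^ j * 2 ^ j := by rw [← mul_pow, ← mul_pow]; norm_num
    refine le_min ?_ ?_
    · calc 16 * Real.sqrt 2 * (8 : ℝ) ^ j * min ((4 * π) ^ 2 * ((2 : ℝ) ^ j)⁻¹ ^ 2 * B₂) ((4 * π) ^ 4 * ((2 : ℝ) ^ j)⁻¹ ^ 4 * B₄)
          ≤ 16 * Real.sqrt 2 * (8 : ℝ) ^ j * ((4 * π) ^ 2 * ((2 : ℝ) ^ j)⁻¹ ^ 2 * B₂) :=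
            mul_le_mul_of_nonneg_left (min_le_left _ _) hc
        _ = a * 2 ^ j := by rw [ha, h8j]; field_simp; ring
    · calc 16 * Real.sqrt 2 * (8 : ℝ) ^ j * min ((4 * π) ^ 2 * ((2 : ℝ) ^ j)⁻¹ ^ 2 * B₂) ((4 * π) ^ 4 * ((2 : ℝ) ^ j)⁻¹ ^ 4 * B₄)
          ≤ 16 * Real.sqrt 2 * (8 : ℝ) ^ j * ((4 * π) ^ 4 * ((2 : ℝ) ^ j)⁻¹ ^ 4 * B₄) :=
            mul_le_mul_of_nonneg_left (min_le_right _ _) hc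
        _ = b / 2 ^ j := by rw [hb, h8j]; field_simp; ring
  calc ∑ z : TorusSite 2 L, ((torusSupNorm z : ℝ) ^ 2) * ‖framePosKernel L K z‖
      ≤ ∑ j ∈ range (Nat.log 2 L + 1), min (a * 2 ^ j) (b / 2 ^ j) := hdy.trans (sum_le_sum fun j _ => hterm j)
    _ ≤ a * 2 ^ t + 2 * b / 2 ^ t := sum_min_geom_le ha0 hb0 _ t
    _ = 256 * Real.sqrt 2 * π ^ 2 * B₂ * 2 ^ t + 8192 * Real.sqrt 2 * π ^ 4 * B₄ / 2 ^ t := by rw [ha, hb]; ring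

end Literature.MathematicalPhysics.QuantumLattice

end
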